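import Mathlib
import HarnessLib
import Summits.HubbardSuperconductivity.HubbardSuperconductivity.Theorems.KLProgrammeKLRegimeSplitEngineV9

/-!
# Route `KLProgramme` — crux K3 `KLRegimeTwoPointLimit`, GEN-6 bundle `klPredsV15`, rider T2 (R-Dq) (plan g14 (R12), STATUS 2026-08-27T05:56:26Z):
# the PROFILE-FREE leg-dressing majorant `legDressBarQ2` and the engine slot VERSION 10 — `PairLadderStepAtV10` / `PairValueIncrementAtV7` /
# `QuarticValueIncrementAtS4` / `QuarticValueUVAtS3` / `EngineBoundsAtV10S` (cell gate-hubbard-kl, seat hubbard-kl-k3c2-p3 g3, named typist of T2)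

FINDING D-PROFILE (k3c2-p3 g3, evidence D-PROFILE.md on stmt-HubbardSuperconductivity-19918; endorsed k3c2-p2 g5, k3c1-p1 g5): the (D) leg-dressing
class of the single-scale step costs, FROM THE SLOTS (`RenormalisedAtF`, `TwoLegSlopes`), `16·cz·Klam·U²` per crossing leg (normal-slope dressing,
`n`-independent, LINEAR in `U`) plus `16·cz·Klam·U²` (thermal piece, k3c2-p2), which the 4^{-n}-profiled quadratic part of
`legDressBarQ G P Q U n c = Q.CR·((Klam U)²·(4^n)⁻¹ + (Klam|U|)³)·c` cannot absorb at deep scales / small `U`; and child 1 never uses the profile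
(`legDressBarQ_le`, `legDressBarQ_countT_sum_le` read only `(4^n)⁻¹ ≤ 1`).  Rider (R-Dq): drop the profile.

* §1 **`legDressBarQ2 G P Q U n c := Q.CR·((P.Klam·U)² + (P.Klam·|U|)³)·c`** (token; `n` kept for slot-shape uniformity), `legDressBarQ2_nonneg`,
  `legDressBarQ2_le` (child 1's per-scale reading, now an identity), **`legDressBarQ2_countT_sum_le`** (`Σ_{n≤N} … ≤ 20·Q.CR·((Klam U)² + (Klam|U|)³)` —
  child 1's scale-sum reading, same bound as `legDressBarQ_countT_sum_le`), `legDressBarQ_le_legDressBarQ2` (the old majorant is below the new one),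
  `legDressBarQ2_zero` (at `n = 0` they coincide), `legDressBarQ2_mono_count`;
* §2 the slot twins by TOKEN SWAP `legDressBarQ ↦ legDressBarQ2` ONLY: `PairLadderStepAtV10` (from `PairLadderStepAtV9`), `PairValueIncrementAtV7`
  (from `…V6`), `QuarticValueIncrementAtS4` (from `…S3`), `QuarticValueUVAtS3` (from `…S2`), and **`EngineBoundsAtV10S`** = `EngineBoundsAtV9S` with
  these four, conjunct ORDER KEPT (child 1's projections `.2.2.1` … survive);
* §3 lifts `…V10_of_V9`, `…V7_of_V6`, `…S4_of_S3`, `…S3_of_S2`, **`engineBoundsAtV10S_of_V9S`** (the V10 budgets are LARGER — every V9S-keyed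
  producer and history composes with one line), projections, and the `n = 0` doors.

Definitions with bodies and order-preserving inequalities; nothing about the model is asserted.
-/

noncomputable section

namespace Summit.HubbardSuperconductivity.HubbardSuperconductivity.Theorems.KLRegimeSplit

set_option linter.dupNamespace false -- summit = problem name (single-conjunct summit), D-0017

open Real Finset Literature.MathematicalPhysics.QuantumLattice Literature.Probability.LatticeModels
open Literature.MathematicalPhysics.QuantumLattice.FermiRG
open Summit.HubbardSuperconductivity.HubbardSuperconductivity.Theorems.KLProgrammeLegKernels

/-! ## §1 The profile-free leg-dressing majorant -/

/-- **`legDressBarQ2 G P Q U n c := Q.CR·((P.Klam·U)² + (P.Klam·|U|)³)·c`** — the leg-dressing majorant WITHOUT the `4^{-n}` profile on its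
quadratic part (rider (R-Dq)); `G` and `n` are not read (kept for the slot-uniform argument order). -/
def legDressBarQ2 (_G : GeoConsts) (P : SplitConsts) (Q : EngConsts) (U : ℝ) (_n c : ℕ) : ℝ :=
  Q.CR * ((P.Klam * U) ^ 2 + (P.Klam * |U|) ^ 3) * c

/-- `legDressBarQ2 ≥ 0` when `Q.CR ≥ 0` and `Klam ≥ 0`. -/
theorem legDressBarQ2_nonneg (G : GeoConsts) {P : SplitConsts} {Q : EngConsts} (hK : 0 ≤ P.Klam) (hQ : 0 ≤ Q.CR) (U : ℝ) (n c : ℕ) :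
    0 ≤ legDressBarQ2 G P Q U n c := by
  unfold legDressBarQ2
  have h2 : 0 ≤ (P.Klam * |U|) ^ 3 := pow_nonneg (mul_nonneg hK (abs_nonneg U)) 3
  exact mul_nonneg (mul_nonneg hQ (add_nonneg (sq_nonneg _) h2)) (Nat.cast_nonneg c)

/-- **Child 1's per-scale reading** (shape of `legDressBarQ_le`): `legDressBarQ2 … n c ≤ Q.CR·((Klam U)² + (Klam|U|)³)·c` (here an identity). -/
theorem legDressBarQ2_le {P : SplitConsts} {Qc : EngConsts} (G : GeoConsts) (_hK : 0 ≤ P.Klam) (_hCR : 0 ≤ Qc.CR) (U : ℝ) (n c : ℕ) :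
    legDressBarQ2 G P Qc U n c ≤ Qc.CR * ((P.Klam * U) ^ 2 + (P.Klam * |U|) ^ 3) * c := le_of_eq rfl

/-- `legDressBarQ2` unfolded. -/
theorem legDressBarQ2_eq (G : GeoConsts) (P : SplitConsts) (Q : EngConsts) (U : ℝ) (n c : ℕ) :
    legDressBarQ2 G P Q U n c = Q.CR * ((P.Klam * U) ^ 2 + (P.Klam * |U|) ^ 3) * c := rfl

/-- **The old majorant is below the new one**: `legDressBarQ … n c ≤ legDressBarQ2 … n c` (`(4^n)⁻¹ ≤ 1`; `Q.CR, Klam ≥ 0`). -/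
theorem legDressBarQ_le_legDressBarQ2 (G : GeoConsts) {P : SplitConsts} {Q : EngConsts} (hK : 0 ≤ P.Klam) (hQ : 0 ≤ Q.CR) (U : ℝ) (n c : ℕ) :
    legDressBarQ G P Q U n c ≤ legDressBarQ2 G P Q U n c := by
  unfold legDressBarQ legDressBarQ2
  have h1 : ((4 : ℝ) ^ n)⁻¹ ≤ 1 := inv_le_one_of_one_le₀ (one_le_pow₀ (by norm_num))
  have h2 : 0 ≤ (P.Klam * U) ^ 2 := sq_nonneg _
  have h3 : 0 ≤ (P.Klam * |U|) ^ 3 := pow_nonneg (mul_nonneg hK (abs_nonneg U)) 3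
  have h4 : (P.Klam * U) ^ 2 * ((4 : ℝ) ^ n)⁻¹ ≤ (P.Klam * U) ^ 2 := by nlinarith
  have hc : (0 : ℝ) ≤ c := Nat.cast_nonneg c
  exact mul_le_mul_of_nonneg_right (mul_le_mul_of_nonneg_left (by linarith) hQ) hc

/-- At `n = 0` the two majorants coincide (`(4^0)⁻¹ = 1`). -/
theorem legDressBarQ2_zero (G : GeoConsts) (P : SplitConsts) (Q : EngConsts) (U : ℝ) (c : ℕ) :
    legDressBarQ2 G P Q U 0 c = legDressBarQ G P Q U 0 c := by
  unfold legDressBarQ2 legDressBarQ; simp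

/-- `legDressBarQ2` is linear in the count: `legDressBarQ2 … n 1 · c = legDressBarQ2 … n c`. -/
theorem legDressBarQ2_one_mul (G : GeoConsts) (P : SplitConsts) (Q : EngConsts) (U : ℝ) (n c : ℕ) :
    legDressBarQ2 G P Q U n 1 * (c : ℝ) = legDressBarQ2 G P Q U n c := by
  unfold legDressBarQ2; push_cast; ring

/-- `legDressBarQ2` is monotone in the count. -/
theorem legDressBarQ2_mono_count (G : GeoConsts) {P : SplitConsts} {Q : EngConsts} (hK : 0 ≤ P.Klam) (hQ : 0 ≤ Q.CR) (U : ℝ)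
    (n : ℕ) {c c' : ℕ} (h : c ≤ c') : legDressBarQ2 G P Q U n c ≤ legDressBarQ2 G P Q U n c' := by
  unfold legDressBarQ2
  have hcub : 0 ≤ (P.Klam * |U|) ^ 3 := pow_nonneg (mul_nonneg hK (abs_nonneg U)) 3
  have h1 : 0 ≤ Q.CR * ((P.Klam * U) ^ 2 + (P.Klam * |U|) ^ 3) := mul_nonneg hQ (add_nonneg (sq_nonneg _) hcub)
  exact mul_le_mul_of_nonneg_left (by exact_mod_cast h) h1

/-- `legDressBarQ2` does not depend on the scale index. -/
theorem legDressBarQ2_succ_eq (G : GeoConsts) (P : SplitConsts) (Q : EngConsts) (U : ℝ) (n c : ℕ) :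
    legDressBarQ2 G P Q U (n + 1) c = legDressBarQ2 G P Q U n c := rfl

section Model

variable (L M : ℕ) [NeZero L] [NeZero M]

omit [NeZero L] [NeZero M] in
/-- **Child 1's scale-sum reading** (shape of `legDressBarQ_countT_sum_le`): along the ladder
`Σ_{n ≤ N} legDressBarQ2 G P Q U n (legSliceCountT … n k) ≤ 20·Q.CR·((Klam U)² + (Klam|U|)³)`. -/
theorem legDressBarQ2_countT_sum_le (G : GeoConsts) {P : SplitConsts} {Q : EngConsts} (hK : 0 ≤ P.Klam) (hQ : 0 ≤ Q.CR)
    (U β μ : ℝ) (K : TrigPolyC4v) (k : Fin 4 → TorusSite 2 L) (N : ℕ) :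
    ∑ n ∈ range (N + 1), legDressBarQ2 G P Q U n (legSliceCountT L β μ K n k) ≤
      20 * (Q.CR * ((P.Klam * U) ^ 2 + (P.Klam * |U|) ^ 3)) := by
  have hcub : 0 ≤ (P.Klam * |U|) ^ 3 := pow_nonneg (mul_nonneg hK (abs_nonneg U)) 3
  simp only [legDressBarQ2_eq]
  rw [← Finset.mul_sum, mul_comm (20 : ℝ)]
  refine mul_le_mul_of_nonneg_left ?_ (mul_nonneg hQ (add_nonneg (sq_nonneg _) hcub))
  exact_mod_cast legSliceCountT_sum_le L β μ K k N

/-! ## §2 The V10 engine slot (token swap `legDressBarQ ↦ legDressBarQ2` only) -/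

/-- **(E2-v10) one pair-ladder step per scale** — `PairLadderStepAtV9` verbatim with `legDressBarQ ↦ legDressBarQ2`. -/
def PairLadderStepAtV10 (G : GeoConsts) (P : SplitConsts) (Q : EngConsts) (β U μ : ℝ) (K : TrigPolyC4v) (n : ℕ) : Prop :=
  (n = 0 → ∀ Qm : TorusSite 2 L, ∀ k ∈ klBall L μ K, ∀ k' ∈ klBall L μ K,
      ‖klPairAmplitude L M β U μ K 0 Qm k k' - (U : ℂ)‖ ≤ initDevBar G U + legDressBarQ2 G P Q U 0 4) ∧
  (1 ≤ n → ∀ Qm : TorusSite 2 L, IsPairClassAt L Qm n →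
      ∃ w : TorusSite 2 L → ℝ, (∑ p, |w p| ≤ G.bhi) ∧ (∑ p, (|w p| - w p) ≤ 2 * klEdge G n (klTorusNorm L Qm)) ∧
        ∃ N : Matrix (TorusSite 2 L) (TorusSite 2 L) ℂ,
          (1 + Matrix.diagonal (fun p => (w p : ℂ)) * klPairArray L M β U μ K (n - 1) Qm) * N = 1 ∧
          ∀ k ∈ klBall L μ K, ∀ k' ∈ klBall L μ K,
            ‖klPairAmplitude L M β U μ K n Qm k k' - (klPairArray L M β U μ K (n - 1) Qm * N) k k'‖ ≤
              drivePBar G P U (n - 1) + eremBar G P Q U β L (n - 1) + thermalBar G P U β n +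
                legDressBarQ2 G P Q U n (legSliceCountT L β μ K n ![k', Qm - k', Qm - k, k]) +
                (P.Klam * U) ^ 2 * (G.phGain n (klTorusNorm L (k - k')) + G.phGain n (klTorusNorm L (k + k' - Qm))))

/-- **(E2″-v7) value increments of the pair arrays** — `PairValueIncrementAtV6` verbatim with `legDressBarQ ↦ legDressBarQ2`. -/
def PairValueIncrementAtV7 (G : GeoConsts) (P : SplitConsts) (Q : EngConsts) (β U μ : ℝ) (K : TrigPolyC4v) (n : ℕ) : Prop :=
  1 ≤ n → ∀ Qm : TorusSite 2 L, ∀ k ∈ klBall L μ K, ∀ k' ∈ klBall L μ K,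
    ‖klPairAmplitude L M β U μ K n Qm k k' - klPairAmplitude L M β U μ K (n - 1) Qm k k'‖ ≤
      gainBar G P U n (klTorusNorm L Qm) (klTorusNorm L (k - k')) (klTorusNorm L (k + k' - Qm)) +
        eremBar G P Q U β L (n - 1) + thermalBar G P U β n +
          legDressBarQ2 G P Q U n (legSliceCountT L β μ K n ![k', Qm - k', Qm - k, k])

/-- **(E2′-S4) pointwise increments of the `↑↓` running coupling values** — `QuarticValueIncrementAtS3` verbatim with
`legDressBarQ ↦ legDressBarQ2`. -/
def QuarticValueIncrementAtS4 (G : GeoConsts) (P : SplitConsts) (Q : EngConsts) (β U μ : ℝ) (K : TrigPolyC4v) (n : ℕ) : Prop :=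
  1 ≤ n → ∀ k₁ ∈ klBall L μ K, ∀ k₂ ∈ klBall L μ K, ∀ k₃ ∈ klBall L μ K,
    ‖klQuarticValue L M β U μ K n 0 1 k₁ k₂ k₃ - klQuarticValue L M β U μ K (n - 1) 0 1 k₁ k₂ k₃‖ ≤
      gainBar G P U n (klTorusNorm L (k₁ + k₃)) (klTorusNorm L (k₁ - k₂)) (klTorusNorm L (k₂ - k₃)) +
        eremBar G P Q U β L (n - 1) + thermalBar G P U β n +
          legDressBarQ2 G P Q U n (legSliceCountT L β μ K n ![k₁, k₂, k₃, k₁ - k₂ + k₃])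

/-- **(E2′-S3 UV) the ultraviolet size of the `↑↓` running coupling values** — `QuarticValueUVAtS2` verbatim with
`legDressBarQ ↦ legDressBarQ2` (at `n = 0` the two tokens coincide, `legDressBarQ2_zero`). -/
def QuarticValueUVAtS3 (G : GeoConsts) (P : SplitConsts) (Q : EngConsts) (β U μ : ℝ) (K : TrigPolyC4v) (n : ℕ) : Prop :=
  n = 0 → ∀ k₁ ∈ klBall L μ K, ∀ k₂ ∈ klBall L μ K, ∀ k₃ ∈ klBall L μ K,
    ‖klQuarticValue L M β U μ K 0 0 1 k₁ k₂ k₃‖ ≤ |U| + initDevBar G U + legDressBarQ2 G P Q U 0 4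

/-- **`EngineBoundsAtV10S`** = `EngineBoundsAtV9S` with (E2-v9) ↦ (E2-v10), (E2″-v6) ↦ (E2″-v7), (E2′-S3) ↦ (E2′-S4), (E2′-S2 UV) ↦ (E2′-S3 UV),
conjunct ORDER KEPT: (E0) ∧ (E1-v4) ∧ (E2-v10) ∧ (E2″-v7) ∧ (E2′-S4) ∧ (E2′-S3 UV) ∧ (E4) ∧ (E5-S). -/
def EngineBoundsAtV10S (G : GeoConsts) (P : SplitConsts) (Q : EngConsts) (β U μ : ℝ) (K : TrigPolyC4v) (n : ℕ) : Prop :=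
  SelfEnergySymmetric L M β U μ K n ∧ KernelNormsV4 L M P Q β U μ K n ∧
    PairLadderStepAtV10 L M G P Q β U μ K n ∧ PairValueIncrementAtV7 L M G P Q β U μ K n ∧
      QuarticValueIncrementAtS4 L M G P Q β U μ K n ∧ QuarticValueUVAtS3 L M G P Q β U μ K n ∧
        EngineFirstMoments L M G P Q β U μ K n ∧ IsoTupleL1AtS L M G P β U μ K n

end Model

/-! ## §3 Lifts from the V9 slot (the V10 budgets are larger), projections, the `n = 0` doors -/

section Model

variable {L M : ℕ} [NeZero L] [NeZero M] {G : GeoConsts} {P : SplitConsts} {Q : EngConsts} {β U μ : ℝ} {K : TrigPolyC4v} {n : ℕ}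

/-- **(E2-v9) ⇒ (E2-v10)** (`Klam, Q.CR ≥ 0`). -/
theorem pairLadderStepAtV10_of_V9 (hK : 0 ≤ P.Klam) (hQ : 0 ≤ Q.CR) (h : PairLadderStepAtV9 L M G P Q β U μ K n) :
    PairLadderStepAtV10 L M G P Q β U μ K n := by
  refine ⟨fun hn Qm k hk k' hk' => ?_, fun hn Qm hQm => ?_⟩
  · rw [legDressBarQ2_zero]; exact h.1 hn Qm k hk k' hk'
  · obtain ⟨w, hm, hneg, N, hN, hbd⟩ := h.2 hn Qm hQm
    refine ⟨w, hm, hneg, N, hN, fun k hk k' hk' => (hbd k hk k' hk').trans ?_⟩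
    have := legDressBarQ_le_legDressBarQ2 G hK hQ U n (legSliceCountT L β μ K n ![k', Qm - k', Qm - k, k])
    linarith

/-- **(E2″-v6) ⇒ (E2″-v7)**. -/
theorem pairValueIncrementAtV7_of_V6 (hK : 0 ≤ P.Klam) (hQ : 0 ≤ Q.CR) (h : PairValueIncrementAtV6 L M G P Q β U μ K n) :
    PairValueIncrementAtV7 L M G P Q β U μ K n := fun hn Qm k hk k' hk' => by
  have := legDressBarQ_le_legDressBarQ2 G hK hQ U n (legSliceCountT L β μ K n ![k', Qm - k', Qm - k, k])
  linarith [h hn Qm k hk k' hk']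

/-- **(E2′-S3) ⇒ (E2′-S4)**. -/
theorem quarticValueIncrementAtS4_of_S3 (hK : 0 ≤ P.Klam) (hQ : 0 ≤ Q.CR) (h : QuarticValueIncrementAtS3 L M G P Q β U μ K n) :
    QuarticValueIncrementAtS4 L M G P Q β U μ K n := fun hn k₁ hk₁ k₂ hk₂ k₃ hk₃ => by
  have := legDressBarQ_le_legDressBarQ2 G hK hQ U n (legSliceCountT L β μ K n ![k₁, k₂, k₃, k₁ - k₂ + k₃])
  linarith [h hn k₁ hk₁ k₂ hk₂ k₃ hk₃]

/-- **(E2′-S2 UV) ⇔ (E2′-S3 UV)** (at `n = 0` the tokens coincide). -/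
theorem quarticValueUVAtS3_iff_S2 : QuarticValueUVAtS3 L M G P Q β U μ K n ↔ QuarticValueUVAtS2 L M G P Q β U μ K n := by
  simp only [QuarticValueUVAtS3, QuarticValueUVAtS2, legDressBarQ2_zero]

/-- (E2′-S2 UV) ⇒ (E2′-S3 UV). -/
theorem quarticValueUVAtS3_of_S2 (h : QuarticValueUVAtS2 L M G P Q β U μ K n) : QuarticValueUVAtS3 L M G P Q β U μ K n :=
  quarticValueUVAtS3_iff_S2.2 h

/-- **`EngineBoundsAtV9S ⇒ EngineBoundsAtV10S`** (`P.WF`, `Q.WF` give the signs): every V9S-keyed producer lifts; a V9 history is a V10 history. -/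
theorem engineBoundsAtV10S_of_V9S (hP : P.WF) (hQ : Q.WF) (h : EngineBoundsAtV9S L M G P Q β U μ K n) :
    EngineBoundsAtV10S L M G P Q β U μ K n := by
  have hK : 0 ≤ P.Klam := zero_le_one.trans hP.1
  have hCR : 0 ≤ Q.CR := hQ.2.1
  exact ⟨h.1, h.2.1, pairLadderStepAtV10_of_V9 hK hCR h.2.2.1, pairValueIncrementAtV7_of_V6 hK hCR h.2.2.2.1,
    quarticValueIncrementAtS4_of_S3 hK hCR h.2.2.2.2.1, quarticValueUVAtS3_of_S2 h.2.2.2.2.2.1, h.2.2.2.2.2.2.1, h.2.2.2.2.2.2.2⟩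

/-- Projection: (E2-v10) is the third conjunct of `EngineBoundsAtV10S` (child 1 reads `.2.2.1`). -/
theorem pairLadderStepAtV10_of_engineBoundsAtV10S (h : EngineBoundsAtV10S L M G P Q β U μ K n) :
    PairLadderStepAtV10 L M G P Q β U μ K n := h.2.2.1

/-- Projection: the conjuncts of `EngineBoundsAtV10S` other than the four (D)-carrying ones are V9S's verbatim. -/
theorem engineBoundsAtV10S_rest (h : EngineBoundsAtV10S L M G P Q β U μ K n) :
    SelfEnergySymmetric L M β U μ K n ∧ KernelNormsV4 L M P Q β U μ K n ∧ EngineFirstMoments L M G P Q β U μ K n ∧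
      IsoTupleL1AtS L M G P β U μ K n :=
  ⟨h.1, h.2.1, h.2.2.2.2.2.2.1, h.2.2.2.2.2.2.2⟩

/-- At `n = 0` (E2-v10) and (E2-v9) agree (the `1 ≤ n` conjunct is void and the UV tokens coincide). -/
theorem pairLadderStepAtV10_iff_V9_zero (G : GeoConsts) (P : SplitConsts) (Q : EngConsts) (β U μ : ℝ) (K : TrigPolyC4v) :
    PairLadderStepAtV10 L M G P Q β U μ K 0 ↔ PairLadderStepAtV9 L M G P Q β U μ K 0 := by
  simp only [PairLadderStepAtV10, PairLadderStepAtV9, Nat.le_zero, one_ne_zero, IsEmpty.forall_iff, and_true, legDressBarQ2_zero]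

/-- At `n = 0` the `1 ≤ n` clauses (E2″-v7) and (E2′-S4) hold vacuously. -/
theorem pairValueIncrementAtV7_zero (G : GeoConsts) (P : SplitConsts) (Q : EngConsts) (β U μ : ℝ) (K : TrigPolyC4v) :
    PairValueIncrementAtV7 L M G P Q β U μ K 0 := fun h => absurd h (by norm_num)

/-- At `n = 0` (E2′-S4) holds vacuously. -/
theorem quarticValueIncrementAtS4_zero (G : GeoConsts) (P : SplitConsts) (Q : EngConsts) (β U μ : ℝ) (K : TrigPolyC4v) :
    QuarticValueIncrementAtS4 L M G P Q β U μ K 0 := fun h => absurd h (by norm_num)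

/-- **At `n = 0` the V10 and V9 engine slots agree.** -/
theorem engineBoundsAtV10S_iff_V9S_zero (G : GeoConsts) (P : SplitConsts) (Q : EngConsts) (β U μ : ℝ) (K : TrigPolyC4v) :
    EngineBoundsAtV10S L M G P Q β U μ K 0 ↔ EngineBoundsAtV9S L M G P Q β U μ K 0 := by
  have h7 : PairValueIncrementAtV7 L M G P Q β U μ K 0 ↔ PairValueIncrementAtV6 L M G P Q β U μ K 0 := by
    simp only [PairValueIncrementAtV7, PairValueIncrementAtV6, Nat.le_zero, one_ne_zero, IsEmpty.forall_iff]
  have h4 : QuarticValueIncrementAtS4 L M G P Q β U μ K 0 ↔ QuarticValueIncrementAtS3 L M G P Q β U μ K 0 := by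
    simp only [QuarticValueIncrementAtS4, QuarticValueIncrementAtS3, Nat.le_zero, one_ne_zero, IsEmpty.forall_iff]
  simp only [EngineBoundsAtV10S, EngineBoundsAtV9S, pairLadderStepAtV10_iff_V9_zero, h7, h4, quarticValueUVAtS3_iff_S2]

end Model

end Summit.HubbardSuperconductivity.HubbardSuperconductivity.Theorems.KLRegimeSplit

end
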